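import Summits.BirchSwinnertonDyer.BirchSwinnertonDyer.Theorems.Rank2ObservatoryCubicFieldR1248276
import HarnessLib

/-!
# BirchSwinnertonDyer — rank ≥ 2 observatory: class number one of the cubic field of `-57 + 139 * X - 25 * X ^ 2 + X ^ 3` (`Δ = 1248276`) — certificates at the primes 307, 311, 313

HONEST FRAMING: per-curve certified theorems and census instruments; no claim on BSD in rank ≥ 2.

Companion of the per-FIELD file `Rank2ObservatoryCubicFieldR1248276` of the KERNEL-2DESC instrument (design
`b2b-bsdr2-cert-3/KERNEL-2DESC.md` §9e–§9g): the degree-one prime-element certificates at the primes 307, 311, 313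
(part c). Split off for file size; generated by the same generator from the same checked data.
Sorry-free; axioms `propext`, `Classical.choice`, `Quot.sound`.
[cite: Marcus2018, Ch. 3 Thm. 27, Ch. 5 Cor. 2 of Thm. 37]
-/

-- single-conjunct summit: `Summit.BirchSwinnertonDyer.BirchSwinnertonDyer.…` repeats the name by design
set_option linter.dupNamespace false

noncomputable section

open scoped Classical NumberField

open Literature.NumberTheory.NumberFields Polynomial Module NumberField

namespace Summit.BirchSwinnertonDyer.BirchSwinnertonDyer.Rank2Observatory.TwoDescCubic

namespace FieldR1248276

/-! ## Class number one -/

/-- Certificate at `307`: every ring map `ψ : 𝓞 K → ℤ/307` kills a prime element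
(`α ↦ 114`: `-488885 + 93731 * α - 3817 * α ^ 2` (norm `307`)). [cite: Marcus2018, Ch. 3, Thm. 27] -/
theorem cert307 (ψ : 𝓞 (CubicField (-25) 139 (-57)) →+* ZMod 307) : ∃ e : 𝓞 (CubicField (-25) 139 (-57)), ψ e = 0 ∧ Prime e := by
  refine cert_of_cases aeval_α ψ (fun t ht hF => ?_)
  have hroots : ∀ t : ZMod 307,
      t ^ 3 + (((-25) : ℤ) : ZMod 307) * t ^ 2 + ((139 : ℤ) : ZMod 307) * t + (((-57) : ℤ) : ZMod 307) = 0 → t = 114 := by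
    decide +kernel
  obtain rfl := hroots t hF
  exact ⟨lin aeval_α (-488885) 93731 (-3817), by simp only [lin, map_add, map_mul, map_pow, map_intCast, ht]; decide,
      lin_prime_of_prime irreducible aeval_α finrank_eq (-488885) 93731 (-3817) (n := 307)
        (by norm_num [MonicCubic.normForm]) (by norm_num)⟩

/-- Certificate at `311`: every ring map `ψ : 𝓞 K → ℤ/311` kills a prime element
(`α ↦ 291`: `-39169 + 7496 * α - 304 * α ^ 2` (norm `311`)). [cite: Marcus2018, Ch. 3, Thm. 27] -/
theorem cert311 (ψ : 𝓞 (CubicField (-25) 139 (-57)) →+* ZMod 311) : ∃ e : 𝓞 (CubicField (-25) 139 (-57)), ψ e = 0 ∧ Prime e := by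
  refine cert_of_cases aeval_α ψ (fun t ht hF => ?_)
  have hroots : ∀ t : ZMod 311,
      t ^ 3 + (((-25) : ℤ) : ZMod 311) * t ^ 2 + ((139 : ℤ) : ZMod 311) * t + (((-57) : ℤ) : ZMod 311) = 0 → t = 291 := by
    decide +kernel
  obtain rfl := hroots t hF
  exact ⟨lin aeval_α (-39169) 7496 (-304), by simp only [lin, map_add, map_mul, map_pow, map_intCast, ht]; decide,
      lin_prime_of_prime irreducible aeval_α finrank_eq (-39169) 7496 (-304) (n := 311)
        (by norm_num [MonicCubic.normForm]) (by norm_num)⟩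

/-- Certificate at `313`: `g` has no root mod `313`, so there is no ring map `𝓞 K → ℤ/313`. [folklore] -/
theorem cert313 (ψ : 𝓞 (CubicField (-25) 139 (-57)) →+* ZMod 313) : ∃ e : 𝓞 (CubicField (-25) 139 (-57)), ψ e = 0 ∧ Prime e :=
  cert_of_no_root aeval_α ψ (by decide +kernel)

end FieldR1248276

end Summit.BirchSwinnertonDyer.BirchSwinnertonDyer.Rank2Observatory.TwoDescCubic

end
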